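import Literature.MathematicalPhysics.QuantumFieldTheory.Balaban1983to89.B14Eq216Concrete
import Literature.MathematicalPhysics.QuantumFieldTheory.Balaban1983to89.B15PrelimIntegrations
import Literature.MathematicalPhysics.QuantumFieldTheory.Balaban1983to89.B15StandardRep
import Literature.MathematicalPhysics.QuantumFieldTheory.Balaban1983to89.B15Eq133JoinDeterminingSet

/-!
# `Balaban1983to89.B15Eq13Concrete` — T. Bałaban, *Large field renormalization. I. The basic step of the 𝐑 operation*,
# Commun. Math. Phys. **122** (1989) 175–202 [Balaban1989LargeFieldI] = «[IV]», p. 178: THE SEVEN GROUPS OF CHARACTERISTIC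
# FUNCTIONS (1.3)–(1.9) and the half-threshold functions (1.88) p. 197 WITH BODY AT PRINT'S INDEX SETS AND CONFIGURATIONS —
# products over the cube ∕ bond ∕ block-pair families of the print, with the background configurations `U_{j,□}(V_j)`
# ([III] (2.16)), `V^{(j)}_{□′} = M^j(U_{j+1,□′})` ([III] (3.4)), `U_{h,□}((1, V_h))` of the tree (r11's `B14.Eq216Concrete.ukBox`,
# `B14.Sect3Decomp.Vbox`), each factor = r12's letter-level predicate (`B15.PrelimIntegrations.SF13`/`SF15`/`gfDensity16`/`SF17`/
# `SF19`/`SFhalf188`) at that instance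

statement-level skeleton of published theorems with citation tags; proofs where landed; nothing here is a claim about
the Yang–Mills mass gap

PDF held: `paper:balaban1989-cmp122-large-field-i` (journal page = PDF page + 174); p. 178 [PDF 4] and pp. 197–198 [PDF 23–24]
READ AS IMAGES on the ×2 renders `run/shared/lean/pub/pub-balaban/b2b-balaban-ref1/pages/1989-cmp122-large-field-I/…-p004-x2.png`,
`…-p023-x2.png`, `…-p024-x2.png` (the text layer of the displays is garbled); [III] = [Balaban1988Convergent] (CMP 119), (2.16)–(2.17) p. 257,
(3.2)–(3.4) p. 265 (renders `…/1988-cmp119-convergent-renormalization/…-p016,p023-x2.png`).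

CITATION HEADER / WHAT IS REPRODUCED (mega-formalization `lit-balaban`, HOME `run/shared/lean/pub/lit-balaban/`; unit
`lit-balaban-r11` gen 109 = B14 owner and PROXY CONSTITUENT for block B15 under the lead's ruling G.5-61 — CLASS B2 member of
`lit-balaban-r11/READING-RULE-PREAUDIT-B15-r11-g109.md` §1).  SKELETON rows served: **B15.Eq1.3–1.4, B15.Eq1.5, B15.Eq1.6,
B15.Eq1.7–1.8, B15.Eq1.9, B15.Eq1.88** (r12's letters p239014; `decomp188` PROVED there).

THE PRINT (p. 178, verbatim): *"Thus ζ(Ω^c_{j+1}∩Z_{j+1})χ(Ω_{j+1}∩Z_{j+1}) is equal to the product of the following seven groups of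
functions: χ({sup_{p⊂□^∼} |U_{j,□}(V_j, ∂p) − 1| < ε_j(L^{k−j}η)²}) (1.3) for □ ⊂ (Ω_j^{∼4}∖Ω^∼_{j+1})∩Z, χ({sup_{p⊂□′^∼} |U_{j+1,□′}
(V_{j+1}, ∂p) − 1| < ε_{j+1}(L^{k−j−1}η)²}) (1.4) for □′ ⊂ (Ω^{∼4}_{j+1}∖Ω^∼_{j+2})∩Z, χ({|V_j(y, x) − 1| < ε_j}) (1.5) for y ∈ (Ω^{∼3}_{j+1}∖
Ω^∼_{j+1})^{(j+1)}∩Z, x ∈ B(y), x ≠ y, (1/z) exp[−(1/g_j²)[1 − Re tr V_j(y, x)]] (1.6) for y ∈ (Ω^{∼3}_{j+1}∖Ω_{j+1})^{(j+1)}∩Z, x ∈ B(y),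
x ≠ y, χ({sup_{b∈(□′^{∼2})^{(k)*}} |V_j(b)(V^{(j)}_□(b))^{−1} − 1| < 2δ_j}) (1.7) for □′ ⊂ (Ω^{∼2}_{j+1}∖Ω_{j+1})∩Z, χ({sup_{b∈(□′^{∼2})^{(k)*}}
|exp ig_jA_j(b)V^{(j)}_{Z_{j+1}∖Z_j}(b)(V^{(j)}_□(b))^{−1} − 1| < 2δ_j}) (1.8) for □′ ⊂ (Ω_{j+1}∖Λ^∼_{j+1})∩Z, χ({sup_{b∈(□′^{∼2})^{(k)*}} |A_j(b)|
< g_j^{−1}δ_j}) (1.9) for □′ ⊂ (Λ^∼_{j+1}∖Λ_{j+1})∩Z. The cubes □ in (1.3) are the LM₂R_j-cubes of the partition of the lattice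
T_{L^{−j}}, or the L^{−(k−j)}LM₂R_j-cubes of the lattice T_η, and the cubes □′ in (1.4), (1.7)–(1.9) are the LM₂R_{j+1}-cubes of the
partition of the lattice T_{L^{−(j+1)}}."*; p. 197: *"we introduce the last decompositions of unity on components of (Ω″^∼_{h+1})ᶜ∩Ω_h:
1 = Σ_P Π_{□⊂Pᶜ} χ({sup_{p⊂□^∼} |U_{h,□}((1, V_h), ∂p) − 1| < ½ε_h(L^{k−h}η)²}) · Π_{□⊂P} χ({… ≧ ½ε_h(L^{k−h}η)²}) = Σ_P χ_{h,1/2}(Pᶜ)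
χ^c_{h,1/2}(P). (1.88) The summation above is over subsets P of a component of the domain (Ω″^∼_{h+1})ᶜ∩Ω_h, which are unions of
LM₂R_h-cubes (for the L^{−h}-scale). The symbol (1, V_h) means the configuration (1↾_{Ω″^{∼2}_{h+1}}, V_h↾_{(Ω″^{∼2}_{h+1})ᶜ})"*.

READING (declared; all of it the cell's standing readings).  (a) CARRIERS: the finest lattice `T_η` of step `k` is `Site P 0`,
`T^{(j)} = Site P j`, `η = P.eta k = L^{−k}`, so `(L^{k−j}η)² = (P.eta j)²` (`eta_pow_mul_eta`, PROVED: the thresholds of (1.3)/(1.4)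
ARE the [III] (2.17)/(3.2) thresholds `ε_j ξ²` at `ξ = L^{−j}`).  (b) CUBE FAMILIES: exactly as in r11's (2.17) `B14.Eq216Concrete.chi217`
and (3.2)–(3.3) `B14.Sect3Decomp` (rows B14.Eq2.17 ∕ Eq3.2–3.4 `proved`): a finite index family with its plaquette set `plaqT □ = {p ⊂ □^∼}`,
its enlargement `enl4 □ = □^{∼4} ⊂ T_η` (the domain of (2.16)), its bond set `bondsStar □′ = (□′^{∼2})^{(·)*}` — print's families
*"□ ⊂ (Ω_j^{∼4}∖Ω^∼_{j+1})∩Z"* etc. are the arguments `X`; the block pairs *"y ∈ …, x ∈ B(y), x ≠ y"* of (1.5)/(1.6) are a finite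
family `S` of pairs with the contour variables `V_j(y, x)` of [I] (0.11) given by a `Setup.ContourData` (as in r11's `B14Eq15Concrete`,
r09's instance `BlockAveragingTwoLevel.contourData`).  (c) CONFIGURATIONS: `U_{j,□}(V_j)` = [III] (2.16) `ukBox bg M₁ □^{∼4} j V_j`
(p365333); `V^{(j)}_{□′}` = [III] (3.4) `M^j(U_{j+1,□′}(V_{j+1}))` = `Vbox (sect3Of …)`; `V^{(j)}_{Z_{j+1}∖Z_j}` of (1.8) = the (1.33)
object (r12's `vSeam133`, row B15.Eq1.33) — an explicit argument `Vseam` here (print defines it only on p. 184); `exp ig_jA_j(b)·` = r12's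
chart `B15StandardRep.expMul`; `(1, V_h)` = `spliceAt` of the trivial configuration on `Ω″^{∼2}_{h+1}` and `V_h` elsewhere.  (d) `χ` of a
condition = the `0/1` real factor (`Setup.chiSmall`, `if … then 1 else 0`), as in (2.17)/(3.3).  The superscript `(k)*` printed in
(1.7)–(1.9) is carried by the bond family `bondsStar` (bonds of the lattice of `V_j`, as in [III] (3.3)); nothing depends on reading it
as `(j)*`.  Every `theorem` below is a definitional unfolding or finite-product bookkeeping; no `Prop` fact, no `sorry`, no new axiom.
v1.1 (same seat, same day; one theorem added, v1 untouched): `chi18_eq_chiPrime` — (1.8) IS [III] (3.3)'s `chiPrime` of the instance at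
the tested field `exp(ig_jA_j)·V^{(j)}_{Z_{j+1}∖Z_j}` (rfl; located by r20 gen 67).
v1.2 (r11 gen 111, 2026-08-25; APPEND-ONLY — one import and §5 added, v1/v1.1 untouched): (1.8)'s seam configuration WITH (1.33)'s
DISPLAYED BODY.  p. 184 defines `V^{(j)}_{Z_{j+1}∖Z_j} = M^j(U(𝔹(Z_{j+1}∖Z_j) ∪ 𝔹_k, M˙(Q^{s*}V)))` by the two-domain (2.14)-join of [III]
p. 257, now in the tree as p29's `B15Eq133JoinDeterminingSet.join133` ∕ `vSeam133join` (p391630) together with print's sentence *"In fact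
in the above case it is simply given by 𝔹_{j+1}(Z_{j+1})↾_{Ω_{j+1}} ∪ 𝔹_j(Z^c_j)↾_{Ω^c_{j+1}}"* PROVED (`Geometry133.join133_eq`) for the
localized sets WITH A SUPPORT IN THEIR DOMAINS (`bUp133`, `bLow133`).  v1's `vSeam18` feeds r12's simplified form `vSeam133` the pair
`Bj M₁ (Z (j+1)) (j+1)`, `Bj M₁ (Z j)ᶜ j`, whose scale-`0` members are the (2.2)-literal GLOBAL `Γ₀ = Ω₁ᶜ` ([III] (2.2) p. 255, render
p013 re-read: *"Γ₀ = Ω^c_1"*; r11's `Bj_zero`): that pair agrees with print's determining set at every positive scale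
(`Geometry133.join133_apply_of_pos`) and differs from it at scale `0` exactly OUTSIDE `Z_{j+1}∖Z_j`, on `Λ_{j+1} ∪ Z_j`
(`Geometry133.join133_ne_unrestricted`, p29's located reading point, seat INBOX 2026-08-25T03:50:46Z) — i.e. outside the support of the
(1.33) variational problem in print's sense ([III] p. 255: *"The domain Ω₁, or rather a small neighborhood of Ω₁ including a layer of
M₁-cubes (M₁η-cubes in the η-lattice), is called its support"*), where print gives no data (the last sentence of (1.33) pins `Q^{s*}V` on
`Ω_{j+1}∩Z_{j+1}` and `Ω^c_{j+1}∩Z^c_j` only, a partition of `Z_{j+1}∖Z_j`).  For the [15] solution map carried as the arbitrary datum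
`DetBackground.U` the two determining sets give different terms, so §5 adds the instance with the DISPLAYED body: **`vSeam18join`** :=
`vSeam133join bg M₁ Ω (Z (j+1)) (Z j) j k (qsV133 Ω V j)` (print's (1.33) verbatim, by name), `vSeam18_eq_vSeam133` (v1 = r12's `vSeam133`
at the unrestricted pair, rfl), **`vSeam18join_eq_vSeam133`** (in the located geometry `Geometry133`, v1.2 = r12's `vSeam133` at the
supported pair — p29's `vSeam133join_qsV133` by name), and (1.8) at that configuration **`chi18join`** with `chi18join_eq_chiPrime` (rfl) and
`chi18join_eq_one_iff`.  Nothing of v1 is re-read: `chi18` takes the seam configuration as an argument, `chi18std` (v1's instance) stays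
for its consumer `B15Claim129AtInstances.setting129Std` (p390622; a twin setting at `vSeam18join` is a field-by-field copy, not filed).
No `Prop` fact, no `sorry`, axioms standard.
-/

noncomputable section

namespace Literature.MathematicalPhysics.QuantumFieldTheory.Balaban1983to89.B15Eq13Concrete

open Literature.MathematicalPhysics.QuantumFieldTheory.Balaban1983to89
open B15DeterminingSets B14.Eq213DetSet B14.Eq216Concrete B14.Sect3Decomp B15.PrelimIntegrations B15StandardRep GaugeField
open Literature.MathematicalPhysics.QuantumFieldTheory.BalabanImbrieJaffe1984to88.BIJ85Eq453GaugeField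
open scoped BigOperators

variable {P : Params}

/-! ## §0  The thresholds: `(L^{k−j}η)² = (L^{−j})²` -/

/-- `η = L^{−k}` and `ξ = L^{−j}`: `L^{k−j}·η = ξ`, i.e. `P.eta j = L^{k−j} · P.eta k` for `j ≤ k` — the (1.3) threshold
`ε_j(L^{k−j}η)²` IS the [III] (2.17) threshold `ε_jξ²` of the `j`-th step. [cite: Balaban1989LargeFieldI, (1.3) p.178] -/
theorem eta_pow_mul_eta {j k : ℕ} (hjk : j ≤ k) : (P.L : ℝ) ^ (k - j) * P.eta k = P.eta j := by
  have hL : (P.L : ℝ) ≠ 0 := by exact_mod_cast (ne_of_gt P.L_pos)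
  unfold Params.eta
  obtain ⟨n, rfl⟩ := Nat.exists_eq_add_of_le hjk
  rw [Nat.add_sub_cancel_left, pow_add, inv_pow, inv_pow, ← mul_assoc, mul_comm ((P.L : ℝ) ^ n), mul_assoc,
    mul_inv_cancel₀ (pow_ne_zero n hL), mul_one]

/-- The threshold identity in the form used below: `ε·(L^{k−j}·η)² = ε·(P.eta j)²`. [cite: Balaban1989LargeFieldI, (1.3) p.178] -/
theorem threshold_eq {j k : ℕ} (hjk : j ≤ k) (ε : ℝ) : ε * ((P.L : ℝ) ^ (k - j) * P.eta k) ^ 2 = ε * P.eta j ^ 2 := by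
  rw [eta_pow_mul_eta hjk]

variable {G : Type*} [GaugeGroup G] {av : ∀ j, Averaging P j G} (bg : DetBackground P G av) (M₁ : ℕ)

/-! ## §1  (1.3) and (1.4): the small-field functions of the backgrounds `U_{j,□}(V_j)` -/

section Eq13

variable {ι : Type*}

/-- **(1.3)** p. 178 [PDF 4] WITH BODY: `Π_{□∈X} χ({sup_{p⊂□^∼} |U_{j,□}(V_j, ∂p) − 1| < ε_j(L^{k−j}η)²})` over print's cube family
`X` (*"□ ⊂ (Ω_j^{∼4}∖Ω^∼_{j+1})∩Z"*, the `LM₂R_j`-cubes of `T_{L^{−j}}`), `plaqT □ = {p ⊂ □^∼}`, `U_{j,□}(V_j) = ukBox bg M₁ □^{∼4} j V_j`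
([III] (2.16)) — this IS r11's [III] (2.17) function `chi217` at scale `j` (threshold `ε_j(P.eta j)² = ε_j(L^{k−j}η)²`, §0).
[cite: Balaban1989LargeFieldI, (1.3) p.178] -/
def chi13 (X : Finset ι) (plaqT : ι → Set (Plaq P 0)) (enl4 : ι → Set (Site P 0)) (ε : ℕ → ℝ) (j : ℕ)
    (V : MSField P G) : ℝ :=
  chi217 bg M₁ X plaqT enl4 (ε j) j (V j)

/-- (1.3) is [III] (2.17) at scale `j` for the field `V_j` (definitional). [cite: Balaban1989LargeFieldI, (1.3) p.178; Balaban1988Convergent, (2.17) p.257] -/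
theorem chi13_eq_chi217 (X : Finset ι) (plaqT : ι → Set (Plaq P 0)) (enl4 : ι → Set (Site P 0)) (ε : ℕ → ℝ) (j : ℕ)
    (V : MSField P G) : chi13 bg M₁ X plaqT enl4 ε j V = chi217 bg M₁ X plaqT enl4 (ε j) j (V j) := rfl

/-- **(1.3) = 1 exactly when every cube's letter-level condition holds**: for `j ≤ k`, `chi13 … = 1` iff for every `□ ∈ X` r12's
`SF13 (plaqT □) ε_j L^{k−j} η (U_{j,□}(V_j))` — the display at PRINT'S INSTANCE (index set = the plaquettes of `□^∼`, configuration =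
`ukBox`, `Lpow = L^{k−j}`, `η = P.eta k`). [cite: Balaban1989LargeFieldI, (1.3) p.178] -/
theorem chi13_eq_one_iff {j k : ℕ} (hjk : j ≤ k) (X : Finset ι) (plaqT : ι → Set (Plaq P 0)) (enl4 : ι → Set (Site P 0))
    (ε : ℕ → ℝ) (V : MSField P G) :
    chi13 bg M₁ X plaqT enl4 ε j V = 1 ↔
      ∀ c ∈ X, SF13 (plaqT c) (ε j) ((P.L : ℝ) ^ (k - j)) (P.eta k) (ukBox bg M₁ (enl4 c) j (V j)) := by
  unfold chi13
  rw [chi217_eq_one_iff]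
  simp only [SF13, threshold_eq hjk]

/-- (1.3) is multiplicative over disjoint cube families — the product over print's family splits along any partition of it
(r11's `chi217_union`; used when the seven groups are compared cube by cube, p. 178). [cite: Balaban1989LargeFieldI, (1.3) p.178] -/
theorem chi13_union [DecidableEq ι] {X Y : Finset ι} (hXY : Disjoint X Y) (plaqT : ι → Set (Plaq P 0))
    (enl4 : ι → Set (Site P 0)) (ε : ℕ → ℝ) (j : ℕ) (V : MSField P G) :
    chi13 bg M₁ (X ∪ Y) plaqT enl4 ε j V = chi13 bg M₁ X plaqT enl4 ε j V * chi13 bg M₁ Y plaqT enl4 ε j V :=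
  chi217_union bg M₁ hXY plaqT enl4 (ε j) j (V j)

/-- **(1.4)** p. 178 WITH BODY: the same function one scale up — `Π_{□′∈X′} χ({sup_{p⊂□′^∼} |U_{j+1,□′}(V_{j+1}, ∂p) − 1| <
ε_{j+1}(L^{k−j−1}η)²})` over print's family `X′` (*"□′ ⊂ (Ω^{∼4}_{j+1}∖Ω^∼_{j+2})∩Z"*, `LM₂R_{j+1}`-cubes of `T_{L^{−(j+1)}}`).
[cite: Balaban1989LargeFieldI, (1.4) p.178] -/
def chi14 (X' : Finset ι) (plaqT : ι → Set (Plaq P 0)) (enl4 : ι → Set (Site P 0)) (ε : ℕ → ℝ) (j : ℕ)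
    (V : MSField P G) : ℝ :=
  chi13 bg M₁ X' plaqT enl4 ε (j + 1) V

/-- (1.4) IS r11's [III] (3.2) function `chiNext` of the `Sect3Data` instance `sect3Of` at step `j` (whose `U_{j+1,□′} = ukBox … (j+1)`),
by `chiNext_sect3Of` (definitional). [cite: Balaban1989LargeFieldI, (1.4) p.178; Balaban1988Convergent, (3.2) p.265] -/
theorem chi14_eq_chiNext {j : ℕ} (D : Sect3Data P G j) (enl4 : D.Cube1 → Set (Site P 0)) (X' : Finset D.Cube1) (ε : ℕ → ℝ)
    (V : MSField P G) :
    chi14 bg M₁ X' D.plaqT enl4 ε j V = chiNext (sect3Of bg M₁ D enl4) (ε (j + 1)) X' (V (j + 1)) := rfl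

/-- (1.4) = 1 iff every `□′ ∈ X′` satisfies r12's `SF13` at scale `j + 1` (`Lpow = L^{k−j−1}`), for `j + 1 ≤ k`.
[cite: Balaban1989LargeFieldI, (1.4) p.178] -/
theorem chi14_eq_one_iff {j k : ℕ} (hjk : j + 1 ≤ k) (X' : Finset ι) (plaqT : ι → Set (Plaq P 0)) (enl4 : ι → Set (Site P 0))
    (ε : ℕ → ℝ) (V : MSField P G) :
    chi14 bg M₁ X' plaqT enl4 ε j V = 1 ↔
      ∀ c ∈ X', SF13 (plaqT c) (ε (j + 1)) ((P.L : ℝ) ^ (k - (j + 1))) (P.eta k) (ukBox bg M₁ (enl4 c) (j + 1) (V (j + 1))) :=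
  chi13_eq_one_iff bg M₁ hjk X' plaqT enl4 ε V

end Eq13

/-! ## §2  (1.5) and (1.6): the block-contour variables `V_j(y, x)` -/

section Eq15

variable {j : ℕ} (cd : ContourData P j G)

open Classical in
/-- **(1.5)** p. 178 WITH BODY: `Π_{(y,x)∈S} χ({|V_j(y, x) − 1| < ε_j})` over print's pair family `S` (*"y ∈ (Ω^{∼3}_{j+1}∖Ω^∼_{j+1})^{(j+1)}
∩Z, x ∈ B(y), x ≠ y"*), `V_j(y, x)` = the contour variable of [I] (0.11) (`cd.holTo`). [cite: Balaban1989LargeFieldI, (1.5) p.178] -/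
def chi15 (S : Finset (Site P (j + 1) × Site P j)) (εj : ℝ) (Vj : GaugeField P j G) : ℝ :=
  ∏ yx ∈ S, if dist1 (cd.holTo Vj yx.1 yx.2) < εj then (1 : ℝ) else 0

/-- (1.5) = 1 iff r12's letter `SF15` holds AT PRINT'S INSTANCE (index set `S`, variables `(y, x) ↦ V_j(y, x) = cd.holTo V_j y x`).
[cite: Balaban1989LargeFieldI, (1.5) p.178] -/
theorem chi15_eq_one_iff (S : Finset (Site P (j + 1) × Site P j)) (εj : ℝ) (Vj : GaugeField P j G) :
    chi15 cd S εj Vj = 1 ↔ SF15 (↑S : Set (Site P (j + 1) × Site P j)) εj (fun yx => cd.holTo Vj yx.1 yx.2) := by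
  classical
  unfold chi15 SF15
  constructor
  · intro h yx hyx
    by_contra hn
    have h0 : (∏ yx ∈ S, if dist1 (cd.holTo Vj yx.1 yx.2) < εj then (1 : ℝ) else 0) = 0 :=
      Finset.prod_eq_zero (Finset.mem_coe.mp hyx) (by simp [hn])
    rw [h0] at h
    exact zero_ne_one h
  · intro h
    exact Finset.prod_eq_one fun yx hyx => by simp [h yx (Finset.mem_coe.mpr hyx)]

/-- **(1.6)** p. 178 WITH BODY: the gauge-fixing density `Π_{(y,x)∈S} (1/z) exp[−(1/g_j²)[1 − Re tr V_j(y, x)]]` over print's pair family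
`S` (*"y ∈ (Ω^{∼3}_{j+1}∖Ω_{j+1})^{(j+1)}∩Z, x ∈ B(y), x ≠ y"*), each factor r12's `gfDensity16` at `V_j(y, x) = cd.holTo V_j y x`.
[cite: Balaban1989LargeFieldI, (1.6) p.178] -/
def gf16 (S : Finset (Site P (j + 1) × Site P j)) (z gj : ℝ) (Vj : GaugeField P j G) : ℝ :=
  ∏ yx ∈ S, gfDensity16 z gj (cd.holTo Vj yx.1 yx.2)

/-- (1.6) unfolded: `Π_{(y,x)∈S} z⁻¹ exp(−g_j^{−2}(1 − Re tr V_j(y, x)))`. [cite: Balaban1989LargeFieldI, (1.6) p.178] -/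
theorem gf16_eq (S : Finset (Site P (j + 1) × Site P j)) (z gj : ℝ) (Vj : GaugeField P j G) :
    gf16 cd S z gj Vj = ∏ yx ∈ S, z⁻¹ * Real.exp (-(1 / gj ^ 2) * (1 - reTr (cd.holTo Vj yx.1 yx.2))) := rfl

/-- The (1.6) density is positive for a positive normalisation `z`. [cite: Balaban1989LargeFieldI, (1.6) p.178] -/
theorem gf16_pos (S : Finset (Site P (j + 1) × Site P j)) {z : ℝ} (hz : 0 < z) (gj : ℝ) (Vj : GaugeField P j G) :
    0 < gf16 cd S z gj Vj :=
  Finset.prod_pos fun _ _ => mul_pos (inv_pos.mpr hz) (Real.exp_pos _)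

end Eq15

/-! ## §3  (1.7), (1.8), (1.9): the approximate-fluctuation functions on the cubes `□′` -/

section Eq17

variable {j : ℕ} (D : Sect3Data P G j) (enl4 : D.Cube1 → Set (Site P 0))

/-- **(1.7)** p. 178 WITH BODY: `Π_{□′∈X} χ({sup_{b∈(□′^{∼2})*} |V_j(b)(V^{(j)}_{□′}(b))^{−1} − 1| < 2δ_j})` over print's family `X`
(*"□′ ⊂ (Ω^{∼2}_{j+1}∖Ω_{j+1})∩Z"*), with `V^{(j)}_{□′} = M^j(U_{j+1,□′}(V_{j+1}))` ([III] (3.4)) — this IS r11's [III] (3.3) function `chiPrime` of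
the instance `sect3Of` at step `j` (threshold `2δ_j`). [cite: Balaban1989LargeFieldI, (1.7) p.178; Balaban1988Convergent, (3.3) p.265] -/
def chi17 (δ : ℕ → ℝ) (X : Finset D.Cube1) (V : MSField P G) : ℝ :=
  chiPrime (sect3Of bg M₁ D enl4) av (2 * δ j) X (V j) (V (j + 1))

/-- `V^{(j)}_{□′}` at print's instance: `M^j(U_{j+1,□′}(V_{j+1})) = Averaging.iter av j (ukBox bg M₁ □′^{∼4} (j+1) V_{j+1})` (definitional,
r11's `Vbox` of the `sect3Of` instance). [cite: Balaban1989LargeFieldI, (1.7) p.178; Balaban1988Convergent, (3.4) p.265] -/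
theorem vbox_apply (c : D.Cube1) (Vj1 : GaugeField P (j + 1) G) :
    Vbox (sect3Of bg M₁ D enl4) av c Vj1 = Averaging.iter av j (ukBox bg M₁ (enl4 c) (j + 1) Vj1) := rfl

/-- The bond families `(□′^{∼2})*` of the instance `sect3Of` are those of the cube geometry `D` (definitional).
[cite: Balaban1988Convergent, (3.3) p.265] -/
theorem bondsStar_sect3Of (c : D.Cube1) : (sect3Of bg M₁ D enl4).bondsStar c = D.bondsStar c := rfl

/-- (1.7) = 1 iff every `□′ ∈ X` satisfies r12's letter `SF17` AT PRINT'S INSTANCE (bond set `(□′^{∼2})*`, tested field `V_j`, reference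
`V^{(j)}_{□′}`). [cite: Balaban1989LargeFieldI, (1.7) p.178] -/
theorem chi17_eq_one_iff (δ : ℕ → ℝ) (X : Finset D.Cube1) (V : MSField P G) :
    chi17 bg M₁ D enl4 δ X V = 1 ↔
      ∀ c ∈ X, SF17 (↑(D.bondsStar c) : Set (PBond P j)) (δ j) (V j) (Vbox (sect3Of bg M₁ D enl4) av c (V (j + 1))) := by
  unfold chi17
  rw [chiPrime_eq_one_iff]
  exact Iff.rfl

open Classical in
/-- **(1.8)** p. 178 WITH BODY: `Π_{□′∈X} χ({sup_{b∈(□′^{∼2})*} |exp ig_jA_j(b)·V^{(j)}_{Z_{j+1}∖Z_j}(b)·(V^{(j)}_{□′}(b))^{−1} − 1| < 2δ_j})` over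
print's family `X` (*"□′ ⊂ (Ω_{j+1}∖Λ^∼_{j+1})∩Z"*): the tested field is `exp(ig_jA_j)·V^{(j)}_{Z_{j+1}∖Z_j}` (r12's chart `expMul`, the
(1.33) configuration `Vseam`), the reference is `V^{(j)}_{□′}`; factor = r12's letter `SF17` at that instance.
[cite: Balaban1989LargeFieldI, (1.8) p.178] -/
def chi18 {𝔤 : Type*} [NormedAddCommGroup 𝔤] [NormedSpace ℝ 𝔤] (χ : LieChart G 𝔤) (g δ : ℕ → ℝ) (X : Finset D.Cube1)
    (Aj : VecField P j 𝔤) (Vseam : GaugeField P j G) (V : MSField P G) : ℝ :=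
  ∏ c ∈ X, if SF17 (↑(D.bondsStar c) : Set (PBond P j)) (δ j) (expMul χ (g j) Aj Vseam)
      (Vbox (sect3Of bg M₁ D enl4) av c (V (j + 1))) then (1 : ℝ) else 0

/-- **(1.8) IS [III] (3.3)'s function at the tested field `exp(ig_jA_j)·V^{(j)}_{Z_{j+1}∖Z_j}`**: `chi18 … A_j Vseam V =
chiPrime (sect3Of …) (2δ_j) X (expMul χ g_j A_j Vseam) V_{j+1}` — definitional (r12's `SF17` on `(□′^{∼2})*` is r11's `SmallApproxFluct`
of the instance, the coincidence `chi17_eq_one_iff` uses); located by the DEFINITIONS steward r20 gen 67.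
[cite: Balaban1989LargeFieldI, (1.8) p.178; Balaban1988Convergent, (3.3) p.265] -/
theorem chi18_eq_chiPrime {𝔤 : Type*} [NormedAddCommGroup 𝔤] [NormedSpace ℝ 𝔤] (χ : LieChart G 𝔤) (g δ : ℕ → ℝ) (X : Finset D.Cube1)
    (Aj : VecField P j 𝔤) (Vseam : GaugeField P j G) (V : MSField P G) :
    chi18 bg M₁ D enl4 χ g δ X Aj Vseam V = chiPrime (sect3Of bg M₁ D enl4) av (2 * δ j) X (expMul χ (g j) Aj Vseam) (V (j + 1)) :=
  rfl

/-- (1.8) = 1 iff every `□′ ∈ X` satisfies `SF17` at print's instance (tested field `exp(ig_jA_j)·V^{(j)}_{Z_{j+1}∖Z_j}`, reference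
`V^{(j)}_{□′}`) — the form in which p. 185 *"the functions (1.8) … are equal to 1"* is proved (`B15SmallField185.sf18_of_reps`).
[cite: Balaban1989LargeFieldI, (1.8) p.178] -/
theorem chi18_eq_one_iff {𝔤 : Type*} [NormedAddCommGroup 𝔤] [NormedSpace ℝ 𝔤] (χ : LieChart G 𝔤) (g δ : ℕ → ℝ) (X : Finset D.Cube1)
    (Aj : VecField P j 𝔤) (Vseam : GaugeField P j G) (V : MSField P G) :
    chi18 bg M₁ D enl4 χ g δ X Aj Vseam V = 1 ↔
      ∀ c ∈ X, SF17 (↑(D.bondsStar c) : Set (PBond P j)) (δ j) (expMul χ (g j) Aj Vseam)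
        (Vbox (sect3Of bg M₁ D enl4) av c (V (j + 1))) := by
  classical
  unfold chi18
  constructor
  · intro h c hc
    by_contra hn
    have h0 : (∏ c ∈ X, if SF17 (↑(D.bondsStar c) : Set (PBond P j)) (δ j) (expMul χ (g j) Aj Vseam)
        (Vbox (sect3Of bg M₁ D enl4) av c (V (j + 1))) then (1 : ℝ) else 0) = 0 :=
      Finset.prod_eq_zero hc (by simp [hn])
    rw [h0] at h
    exact zero_ne_one h
  · intro h
    exact Finset.prod_eq_one fun c hc => by simp [h c hc]

/-- The (1.33) configuration `V^{(j)}_{Z_{j+1}∖Z_j}` AT PRINT'S INSTANCE for (1.8) (p. 184: *"simply given by 𝔹_{j+1}(Z_{j+1})↾_{Ω_{j+1}} ∪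
𝔹_j(Z^c_j)↾_{Ω^c_{j+1}}, and the configuration Q^{s*}V is equal to Q^{s*}_{j+1}V_{j+1} on Ω_{j+1}∩Z_{j+1}, and to Q^{s*}_jV_j on Ω^c_{j+1}∩Z^c_j"*):
r12's `vSeam133` with `𝔹_{j+1}(Z_{j+1}) := Bj M₁ (Z (j+1)) (j+1)`, `𝔹_j(Z_jᶜ) := Bj M₁ (Z j)ᶜ j` ([III] (2.13)) and the fine configuration
spliced from `Q^{s*}_{j+1}V_{j+1}` on `Ω_{j+1}` and `Q^{s*}_jV_j` elsewhere (row B15.Eq1.33 itself stays as the lead ruled; this is only the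
argument of (1.8)). [cite: Balaban1989LargeFieldI, (1.33) p.184, (1.8) p.178] -/
def vSeam18 (Ω Z : ℕ → Set (Site P 0)) (V : MSField P G) : GaugeField P j G :=
  vSeam133 bg (Bj M₁ (Z (j + 1)) (j + 1)) (Bj M₁ (Z j)ᶜ j) (Ω (j + 1))
    (spliceAt (pts 0 (Ω (j + 1))) (qsstarGIter0 (j + 1) (V (j + 1))) (qsstarGIter0 j (V j))) j

/-- (1.8) at print's seam configuration: `chi18` with `Vseam := vSeam18`. [cite: Balaban1989LargeFieldI, (1.8) p.178] -/
def chi18std {𝔤 : Type*} [NormedAddCommGroup 𝔤] [NormedSpace ℝ 𝔤] (χ : LieChart G 𝔤) (g δ : ℕ → ℝ) (X : Finset D.Cube1)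
    (Ω Z : ℕ → Set (Site P 0)) (Aj : VecField P j 𝔤) (V : MSField P G) : ℝ :=
  chi18 bg M₁ D enl4 χ g δ X Aj (vSeam18 bg M₁ Ω Z V) V

open Classical in
/-- **(1.9)** p. 178 WITH BODY: `χ^{(j)}_{□′} = χ({sup_{b∈(□′^{∼2})*} |A_j(b)| < g_j^{−1}δ_j})`, and the product `Π_{□′∈X} χ^{(j)}_{□′}` over print's
family `X` (*"□′ ⊂ (Λ^∼_{j+1}∖Λ_{j+1})∩Z"*; these are the factors of (1.28)–(1.29)), each factor r12's letter `SF19` at the bond set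
`(□′^{∼2})*` and the fluctuation variable `A_j`. [cite: Balaban1989LargeFieldI, (1.9) p.178] -/
def chi19 {𝔤 : Type*} [Norm 𝔤] (g δ : ℕ → ℝ) (X : Finset D.Cube1) (Aj : VecField P j 𝔤) : ℝ :=
  ∏ c ∈ X, if SF19 (↑(D.bondsStar c) : Set (PBond P j)) (g j) (δ j) Aj then (1 : ℝ) else 0

/-- (1.9) = 1 iff every `□′ ∈ X` satisfies `SF19` at print's instance. [cite: Balaban1989LargeFieldI, (1.9) p.178] -/
theorem chi19_eq_one_iff {𝔤 : Type*} [Norm 𝔤] (g δ : ℕ → ℝ) (X : Finset D.Cube1) (Aj : VecField P j 𝔤) :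
    chi19 D g δ X Aj = 1 ↔ ∀ c ∈ X, SF19 (↑(D.bondsStar c) : Set (PBond P j)) (g j) (δ j) Aj := by
  classical
  unfold chi19
  constructor
  · intro h c hc
    by_contra hn
    have h0 : (∏ c ∈ X, if SF19 (↑(D.bondsStar c) : Set (PBond P j)) (g j) (δ j) Aj then (1 : ℝ) else 0) = 0 :=
      Finset.prod_eq_zero hc (by simp [hn])
    rw [h0] at h
    exact zero_ne_one h
  · intro h
    exact Finset.prod_eq_one fun c hc => by simp [h c hc]

/-- **(1.28)** p. 183 at print's instance: `1 = Π_{□′} χ^{(j)}_{□′} + (1 − Π_{□′} χ^{(j)}_{□′})` for the (1.9) product (r12's `decomp128`).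
[cite: Balaban1989LargeFieldI, (1.28) p.183] -/
theorem decomp128_chi19 {𝔤 : Type*} [Norm 𝔤] (g δ : ℕ → ℝ) (X : Finset D.Cube1) (Aj : VecField P j 𝔤) :
    chi19 D g δ X Aj + (1 - chi19 D g δ X Aj) = 1 := by ring

end Eq17

/-! ## §4  (1.88): the half-threshold functions `χ_{h,1/2}` of the configuration `(1, V_h)` and their decomposition of unity -/

section Eq188

variable {ι : Type*}

/-- p. 198 [PDF 24]: *"The symbol (1, V_h) means the configuration (1↾_{Ω″^{∼2}_{h+1}}, V_h↾_{(Ω″^{∼2}_{h+1})^c})"* — the scale-`h` field equal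
to `1` on the bonds meeting `(Ω″^{∼2}_{h+1})^{(h)}` and to `V_h` elsewhere (r12's `spliceAt`). [cite: Balaban1989LargeFieldI, (1.88) p.198] -/
def oneOn (ΩppT2 : Set (Site P 0)) (h : ℕ) (Vh : GaugeField P h G) : GaugeField P h G :=
  spliceAt (pts h ΩppT2) 1 Vh

/-- **(1.88)** p. 197 [PDF 23] WITH BODY: `χ_{h,1/2}(X)((1, V_h)) = Π_{□∈X} χ({sup_{p⊂□^∼} |U_{h,□}((1, V_h), ∂p) − 1| < ½ε_h(L^{k−h}η)²})`
over a family `X` of `LM₂R_h`-cubes (*"subsets P of a component of the domain (Ω″^∼_{h+1})ᶜ∩Ω_h"*), `U_{h,□}(·) = ukBox bg M₁ □^{∼4} h`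
([III] (2.16)); threshold `½ε_h(P.eta h)² = ½ε_h(L^{k−h}η)²` (§0). [cite: Balaban1989LargeFieldI, (1.88) p.197] -/
def chiHalf (X : Finset ι) (plaqT : ι → Set (Plaq P 0)) (enl4 : ι → Set (Site P 0)) (ε : ℕ → ℝ) (h : ℕ)
    (ΩppT2 : Set (Site P 0)) (Vh : GaugeField P h G) : ℝ :=
  ∏ c ∈ X, chiSmall (plaqT c) (1 / 2 * ε h * P.eta h ^ 2) (ukBox bg M₁ (enl4 c) h (oneOn ΩppT2 h Vh))

/-- The complementary function `χ^c_{h,1/2}(X) = Π_{□∈X} χ({… ≧ ½ε_h(L^{k−h}η)²})` of (1.88). [cite: Balaban1989LargeFieldI, (1.88) p.197] -/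
def chiHalfc (X : Finset ι) (plaqT : ι → Set (Plaq P 0)) (enl4 : ι → Set (Site P 0)) (ε : ℕ → ℝ) (h : ℕ)
    (ΩppT2 : Set (Site P 0)) (Vh : GaugeField P h G) : ℝ :=
  ∏ c ∈ X, (1 - chiSmall (plaqT c) (1 / 2 * ε h * P.eta h ^ 2) (ukBox bg M₁ (enl4 c) h (oneOn ΩppT2 h Vh)))

/-- `χ_{h,1/2}(X) = 1` iff every cube of `X` satisfies r12's letter `SFhalf188` AT PRINT'S INSTANCE (plaquettes of `□^∼`, configuration
`U_{h,□}((1, V_h))`, `Lpow = L^{k−h}`, `η = P.eta k`), for `h ≤ k`. [cite: Balaban1989LargeFieldI, (1.88) p.197] -/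
theorem chiHalf_eq_one_iff {h k : ℕ} (hhk : h ≤ k) (X : Finset ι) (plaqT : ι → Set (Plaq P 0)) (enl4 : ι → Set (Site P 0))
    (ε : ℕ → ℝ) (ΩppT2 : Set (Site P 0)) (Vh : GaugeField P h G) :
    chiHalf bg M₁ X plaqT enl4 ε h ΩppT2 Vh = 1 ↔
      ∀ c ∈ X, SFhalf188 (plaqT c) (ε h) ((P.L : ℝ) ^ (k - h)) (P.eta k) (ukBox bg M₁ (enl4 c) h (oneOn ΩppT2 h Vh)) := by
  classical
  have hthr : ∀ c, SFhalf188 (plaqT c) (ε h) ((P.L : ℝ) ^ (k - h)) (P.eta k) (ukBox bg M₁ (enl4 c) h (oneOn ΩppT2 h Vh)) ↔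
      PlaqSmallOn (plaqT c) (1 / 2 * ε h * P.eta h ^ 2) (ukBox bg M₁ (enl4 c) h (oneOn ΩppT2 h Vh)) := fun c => by
    simp only [SFhalf188, mul_assoc, threshold_eq hhk]
  unfold chiHalf
  constructor
  · intro hp c hc
    rw [hthr]
    by_contra hn
    have h0 : ∏ c ∈ X, chiSmall (plaqT c) (1 / 2 * ε h * P.eta h ^ 2) (ukBox bg M₁ (enl4 c) h (oneOn ΩppT2 h Vh)) = 0 :=
      Finset.prod_eq_zero hc (by rw [chiSmall, if_neg hn])
    rw [h0] at hp
    exact zero_ne_one hp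
  · intro hall
    exact Finset.prod_eq_one fun c hc => by rw [chiSmall, if_pos ((hthr c).mp (hall c hc))]

/-- **(1.88), the decomposition of unity, PROVED at print's instance**: `Σ_{P⊆X} χ_{h,1/2}(X∖P)((1, V_h))·χ^c_{h,1/2}(P)((1, V_h)) = 1`
for every cube family `X` (a component of `(Ω″^∼_{h+1})ᶜ∩Ω_h`) — r12's `decomp188` with the concrete factors. [cite: Balaban1989LargeFieldI, (1.88) p.197] -/
theorem eq188 [DecidableEq ι] (X : Finset ι) (plaqT : ι → Set (Plaq P 0)) (enl4 : ι → Set (Site P 0)) (ε : ℕ → ℝ) (h : ℕ)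
    (ΩppT2 : Set (Site P 0)) (Vh : GaugeField P h G) :
    ∑ Pset ∈ X.powerset, chiHalf bg M₁ (X \ Pset) plaqT enl4 ε h ΩppT2 Vh * chiHalfc bg M₁ Pset plaqT enl4 ε h ΩppT2 Vh = 1 :=
  decomp188 X fun c => chiSmall (plaqT c) (1 / 2 * ε h * P.eta h ^ 2) (ukBox bg M₁ (enl4 c) h (oneOn ΩppT2 h Vh))

/-- `χ_{h,1/2}` is (1.3)'s function at scale `h` with HALF the threshold and the configuration `(1, V_h)` in place of `V_h`: as products
over the same cubes, `chiHalf … = chi217 bg M₁ X plaqT enl4 (ε_h/2) h (1, V_h)`. [cite: Balaban1989LargeFieldI, (1.88) p.197, (1.3) p.178] -/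
theorem chiHalf_eq_chi217 (X : Finset ι) (plaqT : ι → Set (Plaq P 0)) (enl4 : ι → Set (Site P 0)) (ε : ℕ → ℝ) (h : ℕ)
    (ΩppT2 : Set (Site P 0)) (Vh : GaugeField P h G) :
    chiHalf bg M₁ X plaqT enl4 ε h ΩppT2 Vh = chi217 bg M₁ X plaqT enl4 (ε h / 2) h (oneOn ΩppT2 h Vh) := by
  unfold chiHalf
  rw [chi217_apply]
  refine Finset.prod_congr rfl fun c _ => ?_
  congr 1
  ring

end Eq188

/-! ## §5  v1.2: (1.8)'s seam configuration `V^{(j)}_{Z_{j+1}∖Z_j}` WITH (1.33)'s DISPLAYED BODY (the (2.14)-join of [III]) -/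

section Eq18Join

open B15Eq133JoinDeterminingSet

variable {j : ℕ} (D : Sect3Data P G j) (enl4 : D.Cube1 → Set (Site P 0))

/-- **`V^{(j)}_{Z_{j+1}∖Z_j}` for (1.8) WITH (1.33)'s DISPLAYED BODY** (p. 184 [PDF 10], verbatim: *"V^{(j)}_{Z_{j+1}∖Z_j} =
M^j(U(𝔹(Z_{j+1}∖Z_j) ∪ 𝔹_k, M˙(Q^{s*}V))), (1.33) where the determining set was defined in (2.14) [III]"*) at print's pins for the
sequences `Ω = {Ω_n}`, `Z = {Z_n}` of the density: p29's `vSeam133join` (the two-domain (2.14)-join `join133 M₁ Ω Z_{j+1} Z_j j k` of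
`𝔹_k = genSet Ω k` with `𝐁_{j+1}(Z_{j+1}∖Z_j)`, `𝐁_j(Z_{j+1}∖Z_j)`, *"summed up over the domains"* [III] p. 257) at the fine
configuration `Q^{s*}V = qsV133 Ω V j` (*"equal to Q^{s*}_{j+1}V_{j+1} on Ω_{j+1}∩Z_{j+1}, and to Q^{s*}_jV_j on Ω^c_{j+1}∩Z^c_j"*; the same
spliced configuration as v1's `vSeam18`).  Everything BY NAME; `k` = the step (top scale of `𝔹_k`).
[cite: Balaban1989LargeFieldI, (1.33) p.184, (1.8) p.178; Balaban1988Convergent, (2.14) p.257] -/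
def vSeam18join (Ω Z : ℕ → Set (Site P 0)) (k : ℕ) (V : MSField P G) : GaugeField P j G :=
  vSeam133join bg M₁ Ω (Z (j + 1)) (Z j) j k (qsV133 Ω V j)

/-- Unfolding of `vSeam18join` down to the solution datum: `M^j(U(join133, M˙(Q^{s*}V)))` (definitional).
[cite: Balaban1989LargeFieldI, (1.33) p.184] -/
theorem vSeam18join_def (Ω Z : ℕ → Set (Site P 0)) (k : ℕ) (V : MSField P G) :
    vSeam18join bg M₁ Ω Z k V =
      Averaging.iter av j (bg.U (join133 M₁ Ω (Z (j + 1)) (Z j) j k) (avgFamily av (qsV133 Ω V j))) := rfl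

/-- v1's `vSeam18` IS r12's simplified form `vSeam133` at the UNRESTRICTED pair `Bj M₁ Z_{j+1} (j+1)`, `Bj M₁ Zᶜ_j j` (scale-`0`
members the (2.2)-literal global `Γ₀ = Ω₁ᶜ`, `B14.Eq213DetSet.Bj_zero`) and the fine configuration `qsV133` — definitional.
[cite: Balaban1989LargeFieldI, (1.33) p.184; Balaban1988Convergent, (2.2) p.255] -/
theorem vSeam18_eq_vSeam133 (Ω Z : ℕ → Set (Site P 0)) (V : MSField P G) :
    vSeam18 bg M₁ Ω Z V =
      vSeam133 bg (Bj M₁ (Z (j + 1)) (j + 1)) (Bj M₁ (Z j)ᶜ j) (Ω (j + 1)) (qsV133 Ω V j) j := rfl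

/-- **v1.2 = print's «in fact» form**: in the located geometry of p. 184 (`Geometry133`: [III] (2.1) nesting
`Ω_{j+2} ⊂ Λ_{j+1} ⊂ Ω_{j+1} ⊂ Λ_j ⊂ Ω_j` with `Z_n = Λᶜ_n`, the (3.5)/(3.20) separations, `1 ≤ j`, `j + 1 ≤ k`), `vSeam18join` IS
r12's `vSeam133` at the localized determining sets WITH A SUPPORT IN THEIR DOMAINS, `𝔹_{j+1}(Z_{j+1}) = bUp133`, `𝔹_j(Zᶜ_j) =
bLow133` — p29's `vSeam133join_qsV133` (the kernel theorem `Geometry133.join133_eq`) by name.  With v1's unrestricted pair the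
determining sets agree at every positive scale (`Geometry133.join133_apply_of_pos`) and differ at scale `0` outside `Z_{j+1}∖Z_j`
(`Geometry133.join133_ne_unrestricted`), outside the support of the problem ([III] p. 255).
[cite: Balaban1989LargeFieldI, (1.33) p.184; Balaban1988Convergent, (2.13)–(2.14) pp.256–257] -/
theorem vSeam18join_eq_vSeam133 {Ω Z : ℕ → Set (Site P 0)} {k : ℕ} (H : Geometry133 P M₁ Ω (Z (j + 1)) (Z j) j k)
    (V : MSField P G) :
    vSeam18join bg M₁ Ω Z k V =
      vSeam133 bg (bUp133 M₁ (Z (j + 1)) j) (bLow133 M₁ (Z j) j) (Ω (j + 1)) (qsV133 Ω V j) j :=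
  vSeam133join_qsV133 bg H V

/-- **(1.8) at the seam configuration with (1.33)'s displayed body**: `chi18` with `Vseam := vSeam18join` (cf. v1's `chi18std` at
`vSeam18`). [cite: Balaban1989LargeFieldI, (1.8) p.178, (1.33) p.184] -/
def chi18join {𝔤 : Type*} [NormedAddCommGroup 𝔤] [NormedSpace ℝ 𝔤] (χ : LieChart G 𝔤) (g δ : ℕ → ℝ) (X : Finset D.Cube1)
    (Ω Z : ℕ → Set (Site P 0)) (k : ℕ) (Aj : VecField P j 𝔤) (V : MSField P G) : ℝ :=
  chi18 bg M₁ D enl4 χ g δ X Aj (vSeam18join bg M₁ Ω Z k V) V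

/-- `chi18join` IS [III] (3.3)'s `chiPrime` of the instance `sect3Of` at the tested field `exp(ig_jA_j)·V^{(j)}_{Z_{j+1}∖Z_j}` with the
displayed (1.33) body (definitional, as `chi18_eq_chiPrime`). [cite: Balaban1989LargeFieldI, (1.8) p.178; Balaban1988Convergent, (3.3) p.265] -/
theorem chi18join_eq_chiPrime {𝔤 : Type*} [NormedAddCommGroup 𝔤] [NormedSpace ℝ 𝔤] (χ : LieChart G 𝔤) (g δ : ℕ → ℝ)
    (X : Finset D.Cube1) (Ω Z : ℕ → Set (Site P 0)) (k : ℕ) (Aj : VecField P j 𝔤) (V : MSField P G) :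
    chi18join bg M₁ D enl4 χ g δ X Ω Z k Aj V =
      chiPrime (sect3Of bg M₁ D enl4) av (2 * δ j) X (expMul χ (g j) Aj (vSeam18join bg M₁ Ω Z k V)) (V (j + 1)) := rfl

/-- `chi18join = 1` iff every `□′ ∈ X` satisfies r12's letter `SF17` at print's instance: bond set `(□′^{∼2})*`, tested field
`exp(ig_jA_j)·V^{(j)}_{Z_{j+1}∖Z_j}` with the displayed (1.33) body, reference `V^{(j)}_{□′}`. [cite: Balaban1989LargeFieldI, (1.8) p.178] -/
theorem chi18join_eq_one_iff {𝔤 : Type*} [NormedAddCommGroup 𝔤] [NormedSpace ℝ 𝔤] (χ : LieChart G 𝔤) (g δ : ℕ → ℝ)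
    (X : Finset D.Cube1) (Ω Z : ℕ → Set (Site P 0)) (k : ℕ) (Aj : VecField P j 𝔤) (V : MSField P G) :
    chi18join bg M₁ D enl4 χ g δ X Ω Z k Aj V = 1 ↔
      ∀ c ∈ X, SF17 (↑(D.bondsStar c) : Set (PBond P j)) (δ j) (expMul χ (g j) Aj (vSeam18join bg M₁ Ω Z k V))
        (Vbox (sect3Of bg M₁ D enl4) av c (V (j + 1))) :=
  chi18_eq_one_iff bg M₁ D enl4 χ g δ X Aj _ V

/-- In the located geometry, (1.8) with the displayed body IS (1.8) at r12's simplified form with the SUPPORTED pair — the function the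
p. 185 argument (*"the functions (1.8) … are equal to 1"*) is about. [cite: Balaban1989LargeFieldI, (1.8) p.178, (1.33) p.184] -/
theorem chi18join_eq_chi18_supported {𝔤 : Type*} [NormedAddCommGroup 𝔤] [NormedSpace ℝ 𝔤] (χ : LieChart G 𝔤) (g δ : ℕ → ℝ)
    (X : Finset D.Cube1) {Ω Z : ℕ → Set (Site P 0)} {k : ℕ} (H : Geometry133 P M₁ Ω (Z (j + 1)) (Z j) j k)
    (Aj : VecField P j 𝔤) (V : MSField P G) :
    chi18join bg M₁ D enl4 χ g δ X Ω Z k Aj V =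
      chi18 bg M₁ D enl4 χ g δ X Aj
        (vSeam133 bg (bUp133 M₁ (Z (j + 1)) j) (bLow133 M₁ (Z j) j) (Ω (j + 1)) (qsV133 Ω V j) j) V := by
  unfold chi18join
  rw [vSeam18join_eq_vSeam133 bg M₁ H V]

end Eq18Join

end Literature.MathematicalPhysics.QuantumFieldTheory.Balaban1983to89.B15Eq13Concrete

end
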